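import Mathlib
import HarnessLib
import Literature.MathematicalPhysics.StatisticalMechanics.PolymerProductLipschitzABKM
import Literature.MathematicalPhysics.StatisticalMechanics.FluctuationPolymer
import Literature.MathematicalPhysics.StatisticalMechanics.FluctuationSmooth
import Literature.MathematicalPhysics.StatisticalMechanics.RenormalisationMapExpansion
import Literature.MathematicalPhysics.StatisticalMechanics.ActivitySpace

/-!
# The inner factor `R_{k+1}[P₂(e^{−H},K)(X₂)]` of the renormalisation map, for the torus data:
# smoothness, locality, the bound `|R P₂(X₂)|_{T_{X₂}, w_{k:k+1}^{X₂}} ≤ b_{P₂} · A_𝒫^{|X₂|_k}` and its Lipschitz form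

In the reblocked form `S(H,K)(U) = Σ_{π(X)=U} Σ_{X₁ ⊆ X} (e^{−H̃})^{U∖X}(e^{H̃})^{X∖U}(1−e^{−H̃})^{X₁}
R_{k+1}[P₂(e^{−H},K)(X∖X₁)]` ([ABKM19] Ch. 9.1; `GradientRG.nextKStep_eq_sum`) the last factor is the map
`R₁ ∘ P₂` of Lemma 9.4 / Lemma 9.7 evaluated on the (not necessarily connected) `k`-polymer
`X₂ = X ∖ X₁`.  This file packages, for the concrete torus tower (`abkmNormParams`, `abkmWeightData`
with `AbkmWeightBounds`), everything the `P₁`-estimate needs about this factor: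

* `contDiff_polyP2`, `isGaugeLocal_fluct` — generic smoothness of `P₂` and locality of `R`;
* `isGaugeLocal_polyP2_abkm` — `P₂(e^{−H},K)(X₂)` is local for the gauge `T_k^{X₂*}`;
* `tayNormLE_polyP2_abkm` — Lemma 9.4 (zeroth order) with head symbol `polyP2`
  (`PolymerProductABKM.tayNormLE_P2_abkm`);
* **`tayNormLE_fluct_polyP2_abkm`** — `|R_{k+1}P₂(X₂)|_{T_k^{X₂*}, w_{k:k+1}^{X₂}} ≤ b_{P₂}(H,K,X₂)·A_𝒫^{|X₂|_k}`
  (Lemma 9.4 + Lemma 8.4 on arbitrary polymers, `FluctuationPolymer.tayNormLE_fluct_abkm`);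
* **`tayNormLE_fluct_polyP2_sub_abkm`** — the Lipschitz form
  `|R_{k+1}P₂(e^{−H},K)(X₂) − R_{k+1}P₂(e^{−H'},K')(X₂)| ≤ b'_{P₂}·A_𝒫^{|X₂|_k}` from
  `PolymerProductLipschitzABKM.tayNormLE_P2_sub_abkm` and linearity of `R_{k+1}` on integrable functionals;
* `contDiff_fluct_polyP2_abkm`, `isGaugeLocal_fluct_polyP2_abkm`.

Everything is proved; no named fact.

## References
* S. Adams, S. Buchholz, R. Kotecký, S. Müller, arXiv:1910.13564, Lemma 9.4, Lemma 9.7 (the map R₁),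
  Lemma 8.4, Ch. 9.1 [AdamsBuchholzKoteckyMuller2019].
-/

noncomputable section

namespace Literature.MathematicalPhysics.StatisticalMechanics.GradientRG

open scoped BigOperators Classical
open Finset MeasureTheory
open Literature.MathematicalPhysics.StatisticalMechanics.TorusPolymer
  (IsPolymer blocks polys bprod blockOf thicken mem_polys mem_blocks numBlocks)
open Literature.Barriers.CriticalPhenomena.LongRangePhi4.Polymer (IsConn components)
open Literature.MathematicalPhysics.QuantumFieldTheory

variable {d M : ℕ} [NeZero M]

/-! ## Generic smoothness and locality -/

/-- `P₂(e^{−H},K)(Z)` is `C^{r₀}` when every `K(Y)` is. [cite: AdamsBuchholzKoteckyMuller2019, Lemma 9.4] -/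
theorem contDiff_polyP2 (s : ℕ) (H : RelevantHamiltonian ℂ d)
    {K : Finset (Fin d → ZMod M) → ((Fin d → ZMod M) → ℝ) → ℂ} {r₀ : ℕ}
    (hKd : ∀ Y, ContDiff ℝ r₀ (K Y)) (Z : Finset (Fin d → ZMod M)) :
    ContDiff ℝ r₀ (polyP2 s H K Z) := by
  have hfun : polyP2 s H K Z = fun ψ => ∑ Y ∈ polys s Z,
      bprod s (fun B => expNegH H B ψ - 1) (Z \ Y) * K Y ψ := by
    funext ψ; rfl
  rw [hfun]
  refine ContDiff.sum fun Y _ => ContDiff.mul ?_ (hKd Y)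
  unfold TorusPolymer.bprod
  exact contDiff_prod fun B _ => ((contDiff_eval H B (n := r₀)).neg.cexp).sub contDiff_const

/-- **`R` preserves locality**: `φ ↦ ∫ F(φ + ξ) μ_{k+1}(dξ)` is `T`-local when `F` is.
[cite: AdamsBuchholzKoteckyMuller2019, Lemma 6.4 (2)] -/
theorem isGaugeLocal_fluct {V : Type*} [NormedAddCommGroup V] [NormedSpace ℝ V]
    (T : ((Fin d → ZMod M) → ℝ) →ₗ[ℝ] V) (𝒞 : (Fin d → ZMod M) → ℝ)
    {F : ((Fin d → ZMod M) → ℝ) → ℂ} (hF : IsGaugeLocal T F) : IsGaugeLocal T (fluct 𝒞 F) := by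
  unfold fluct
  exact isGaugeLocal_integral T (stepMeasure 𝒞) fun ξ => hF.comp_add_right _ ξ

/-! ## The torus data -/

/-- **`P₂(e^{−H},K)(Z)` is local for `T_k^{Z*}`** (`Z` a `k`-polymer; `K` factorising with `K(∅) = 1`
and local on connected polymers; odd torus `M = L^N`, `k ≤ N`).
[cite: AdamsBuchholzKoteckyMuller2019, Lemma 6.3 / Lemma 9.4] -/
theorem isGaugeLocal_polyP2_abkm {L N Mord R p r₀ : ℕ} {θbar h A : ℝ} {δ : ℕ → ℝ}
    {𝒞 : ℕ → (Fin d → ZMod M) → ℝ} (hLodd : Odd L) (hM : M = L ^ N) {k : ℕ} (hk : k ≤ N)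
    (hh : 0 < h) (hp : d / 2 + 1 ≤ p) (H : RelevantHamiltonian ℂ d)
    {K : Finset (Fin d → ZMod M) → ((Fin d → ZMod M) → ℝ) → ℂ}
    (hKfac : Factorises (L ^ k) K) (hK0 : ∀ φ, K ∅ φ = 1)
    (hKloc : ∀ Y, IsPolymer (L ^ k) Y → IsConn Y →
      IsGaugeLocal ((abkmNormParams L N Mord R p r₀ h θbar A δ 𝒞).gauge k Y) (K Y))
    {Z : Finset (Fin d → ZMod M)} (hZ : IsPolymer (L ^ k) Z) :
    IsGaugeLocal ((abkmNormParams L N Mord R p r₀ h θbar A δ 𝒞).gauge k Z) (polyP2 (L ^ k) H K Z) := by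
  set P := abkmNormParams L N Mord R p r₀ h θbar A δ 𝒞 with hP
  have hL0 : (0 : ℝ) < L := by exact_mod_cast hLodd.pos
  obtain ⟨t, ht⟩ : ∃ t, N = k + t := ⟨N - k, by omega⟩
  have hMt : M = L ^ k * L ^ t := by rw [← pow_add, ← ht]; exact hM
  have h𝔥 : 0 < P.𝔥 k := fieldWt_pos hh hL0 d k
  have hR : 0 < P.R k := by show (0 : ℝ) < (L : ℝ) ^ k; positivity
  have hfun : polyP2 (L ^ k) H K Z = fun ψ => ∑ Y ∈ polys (L ^ k) Z,
      bprod (L ^ k) (fun B => expNegH H B ψ - 1) (Z \ Y) * K Y ψ := by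
    funext ψ; rfl
  rw [hfun]
  refine isGaugeLocal_finset_sum _ _ fun Y hY => ?_
  obtain ⟨hYZ, hYp⟩ := mem_polys.1 hY
  have h1 : IsGaugeLocal (P.gauge k Z) (fun ψ => bprod (L ^ k) (fun B => expNegH H B ψ - 1) (Z \ Y)) := by
    unfold TorusPolymer.bprod
    refine IsGaugeLocal.prod _ fun B hB => ?_
    have hBZ : B ⊆ Z := (hZ.sdiff hYp).subset_of_mem_blocks hB |>.trans sdiff_subset
    obtain ⟨x, -, rfl⟩ := mem_blocks.1 hB
    have hloc : IsGaugeLocal (P.gauge k (blockOf (L ^ k) x))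
        (fun ψ : (Fin d → ZMod M) → ℝ => expNegH H (blockOf (L ^ k) x) ψ - 1) :=
      IsGaugeLocal.op₁ _ (fun z : ℂ => z - 1) (isGaugeLocal_cexp_neg_eval h𝔥.ne' hR.ne' hp
        (TorusPolymer.subset_thicken _ _) H)
    exact hloc.of_norm_le fun ξ => norm_fieldGauge_mono_set _ _ _ (TorusPolymer.thicken_mono _ hBZ) ξ
  have h2 : IsGaugeLocal (P.gauge k Z) (K Y) :=
    (isGaugeLocal_of_factorises_polys hMt hLodd.pow hLodd.pow hKfac hK0 hKloc hYp).of_norm_le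
      fun ξ => norm_fieldGauge_mono_set _ _ _ (TorusPolymer.thicken_mono _ hYZ) ξ
  exact h1.mul h2

/-- **Lemma 9.4 (zeroth order) with head symbol `polyP2`**: the statement of
`PolymerProductABKM.tayNormLE_P2_abkm` for `polyP2 (L^k) H K X`.
[cite: AdamsBuchholzKoteckyMuller2019, Lemma 9.4 (9.19)] -/
theorem tayNormLE_polyP2_abkm {L N Mord R n p r₀ : ℕ} {θbar lam μ δ₁ δ₀ A𝒫 h A : ℝ}
    {𝒞 : ℕ → (Fin d → ZMod M) → ℝ} (hd : 2 ≤ d) (hLodd : Odd L)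
    (hM : M = L ^ N) {k : ℕ} (hkN : k + 1 ≤ N) (hp : d / 2 + 1 ≤ p) (hMord : d / 2 + 1 ≤ Mord)
    (hB : AbkmWeightBounds L N Mord R n θbar lam μ δ₁ δ₀ A𝒫 𝒞
      (abkmWeightData L N Mord R θbar (schedDelta δ₀ δ₁ N) 𝒞))
    (hδ₀ : 0 < δ₀) (hδ₁ : 0 < δ₁) (hh : 0 < h) (hh0 : hZeroSq d R δ₀ δ₁ ≤ h ^ 2) (hA : 0 < A)
    {X : Finset (Fin d → ZMod M)} (hX : IsPolymer (L ^ k) X)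
    {H : RelevantHamiltonian ℂ d}
    (hH : hamNorm (fieldWt h (L : ℝ) d k) ((L : ℝ) ^ k) (L ^ (d * k)) H ≤ 1 / 8)
    {K : Finset (Fin d → ZMod M) → ((Fin d → ZMod M) → ℝ) → ℂ} {C : ℝ} (hC : 0 ≤ C)
    (hK : WeakNormLE (abkmNormParams L N Mord R p r₀ h θbar A (schedDelta δ₀ δ₁ N) 𝒞) k K C)
    (hKfac : Factorises (L ^ k) K) (hK0 : ∀ φ, K ∅ φ = 1) (hKd : ∀ Y, ContDiff ℝ r₀ (K Y))
    (hKloc : ∀ Y, IsPolymer (L ^ k) Y → IsConn Y →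
      IsGaugeLocal ((abkmNormParams L N Mord R p r₀ h θbar A (schedDelta δ₀ δ₁ N) 𝒞).gauge k Y) (K Y)) :
    TayNormLE ((abkmNormParams L N Mord R p r₀ h θbar A (schedDelta δ₀ δ₁ N) 𝒞).gauge k X) r₀
      ((abkmWeightData L N Mord R θbar (schedDelta δ₀ δ₁ N) 𝒞).weight k X)
      (polyP2 (L ^ k) H K X)
      (∑ Y ∈ polys (L ^ k) X, (∏ _B ∈ blocks (L ^ k) (X \ Y),
        8 * Real.exp (1 / 4) * hamNorm (fieldWt h (L : ℝ) d k) ((L : ℝ) ^ k) (L ^ (d * k)) H) *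
        ∏ Z ∈ components Y, C * (abkmNormParams L N Mord R p r₀ h θbar A (schedDelta δ₀ δ₁ N) 𝒞).aFactor k Z) := by
  have h := tayNormLE_P2_abkm hd hLodd hM hkN hp hMord hB hδ₀ hδ₁ hh hh0 hA hX hH hC hK hKfac hK0 hKd hKloc
  have hfun : polyP2 (L ^ k) H K X = fun ψ => ∑ Y ∈ polys (L ^ k) X,
      bprod (L ^ k) (fun B => expNegH H B ψ - 1) (X \ Y) * K Y ψ := by
    funext ψ; rfl
  rw [hfun]
  exact h

/-- **`|R_{k+1}P₂(e^{−H},K)(X₂)|_{T_k^{X₂*}, w_{k:k+1}^{X₂}} ≤ b_{P₂}(H,K,X₂) · A_𝒫^{|X₂|_k}`** for every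
`k`-polymer `X₂` (`θ̄, λ > 0`; hypotheses of `tayNormLE_polyP2_abkm`): Lemma 9.4 followed by Lemma 8.4 on
arbitrary polymers. [cite: AdamsBuchholzKoteckyMuller2019, Lemma 9.4 / Lemma 9.7 (R₁) / Lemma 8.4] -/
theorem tayNormLE_fluct_polyP2_abkm {L N Mord R n p r₀ : ℕ} {θbar lam μ δ₁ δ₀ A𝒫 h A : ℝ}
    {𝒞 : ℕ → (Fin d → ZMod M) → ℝ} (hd : 2 ≤ d) (hLodd : Odd L)
    (hM : M = L ^ N) {k : ℕ} (hkN : k + 1 ≤ N) (hp : d / 2 + 1 ≤ p) (hMord : d / 2 + 1 ≤ Mord)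
    (hθbar : 0 < θbar) (hlam : 0 < lam)
    (hB : AbkmWeightBounds L N Mord R n θbar lam μ δ₁ δ₀ A𝒫 𝒞
      (abkmWeightData L N Mord R θbar (schedDelta δ₀ δ₁ N) 𝒞))
    (hδ₀ : 0 < δ₀) (hδ₁ : 0 < δ₁) (hh : 0 < h) (hh0 : hZeroSq d R δ₀ δ₁ ≤ h ^ 2) (hA : 0 < A)
    {X : Finset (Fin d → ZMod M)} (hX : IsPolymer (L ^ k) X)
    {H : RelevantHamiltonian ℂ d}
    (hH : hamNorm (fieldWt h (L : ℝ) d k) ((L : ℝ) ^ k) (L ^ (d * k)) H ≤ 1 / 8)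
    {K : Finset (Fin d → ZMod M) → ((Fin d → ZMod M) → ℝ) → ℂ} {C : ℝ} (hC : 0 ≤ C)
    (hK : WeakNormLE (abkmNormParams L N Mord R p r₀ h θbar A (schedDelta δ₀ δ₁ N) 𝒞) k K C)
    (hKfac : Factorises (L ^ k) K) (hK0 : ∀ φ, K ∅ φ = 1) (hKd : ∀ Y, ContDiff ℝ r₀ (K Y))
    (hKloc : ∀ Y, IsPolymer (L ^ k) Y → IsConn Y →
      IsGaugeLocal ((abkmNormParams L N Mord R p r₀ h θbar A (schedDelta δ₀ δ₁ N) 𝒞).gauge k Y) (K Y)) :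
    TayNormLE ((abkmNormParams L N Mord R p r₀ h θbar A (schedDelta δ₀ δ₁ N) 𝒞).gauge k X) r₀
      ((abkmWeightData L N Mord R θbar (schedDelta δ₀ δ₁ N) 𝒞).midWeight k X)
      (fluct (𝒞 (k + 1)) (polyP2 (L ^ k) H K X))
      ((∑ Y ∈ polys (L ^ k) X, (∏ _B ∈ blocks (L ^ k) (X \ Y),
        8 * Real.exp (1 / 4) * hamNorm (fieldWt h (L : ℝ) d k) ((L : ℝ) ^ k) (L ^ (d * k)) H) *
        ∏ Z ∈ components Y, C * (abkmNormParams L N Mord R p r₀ h θbar A (schedDelta δ₀ δ₁ N) 𝒞).aFactor k Z) *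
        A𝒫 ^ numBlocks (L ^ k) X) := by
  set P := abkmNormParams L N Mord R p r₀ h θbar A (schedDelta δ₀ δ₁ N) 𝒞 with hP
  have hL0 : (0 : ℝ) < L := by exact_mod_cast hLodd.pos
  have hk1 : k + 1 ≤ N + 1 := by omega
  have hP2 := tayNormLE_polyP2_abkm hd hLodd hM hkN hp hMord hB hδ₀ hδ₁ hh hh0 hA hX hH hC hK hKfac hK0 hKd hKloc
  have hnn : 0 ≤ hamNorm (fieldWt h (L : ℝ) d k) ((L : ℝ) ^ k) (L ^ (d * k)) H :=
    hamNorm_nonneg (fieldWt_pos hh hL0 d k).le (by positivity) _ H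
  have hb0 : (0 : ℝ) ≤ ∑ Y ∈ polys (L ^ k) X, (∏ _B ∈ blocks (L ^ k) (X \ Y),
      8 * Real.exp (1 / 4) * hamNorm (fieldWt h (L : ℝ) d k) ((L : ℝ) ^ k) (L ^ (d * k)) H) *
      ∏ Z ∈ components Y, C * P.aFactor k Z :=
    sum_nonneg fun Y _ => mul_nonneg (prod_nonneg fun _ _ => by positivity)
      (prod_nonneg fun Z _ => mul_nonneg hC (WeakNormLE.aFactor_pos hA k Z).le)
  exact tayNormLE_fluct_abkm hθbar hlam hB hk1 hX (P.gauge k X) hb0 (contDiff_polyP2 _ H hKd X)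
    (isGaugeLocal_polyP2_abkm hLodd hM (by omega) hh hp H hKfac hK0 hKloc hX) hP2

/-- **`R_{k+1}P₂(e^{−H},K)(X₂)` is `C^{r₀}`** (torus data, hypotheses of `tayNormLE_fluct_polyP2_abkm`).
[cite: AdamsBuchholzKoteckyMuller2019, Lemma 8.4 / Lemma 9.4] -/
theorem contDiff_fluct_polyP2_abkm {L N Mord R n p r₀ : ℕ} {θbar lam μ δ₁ δ₀ A𝒫 h A : ℝ}
    {𝒞 : ℕ → (Fin d → ZMod M) → ℝ} (hd : 2 ≤ d) (hLodd : Odd L)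
    (hM : M = L ^ N) {k : ℕ} (hkN : k + 1 ≤ N) (hp : d / 2 + 1 ≤ p) (hMord : d / 2 + 1 ≤ Mord)
    (hθbar : 0 < θbar) (hlam : 0 < lam)
    (hB : AbkmWeightBounds L N Mord R n θbar lam μ δ₁ δ₀ A𝒫 𝒞
      (abkmWeightData L N Mord R θbar (schedDelta δ₀ δ₁ N) 𝒞))
    (hδ₀ : 0 < δ₀) (hδ₁ : 0 < δ₁) (hh : 0 < h) (hh0 : hZeroSq d R δ₀ δ₁ ≤ h ^ 2) (hA : 0 < A)
    {X : Finset (Fin d → ZMod M)} (hX : IsPolymer (L ^ k) X)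
    {H : RelevantHamiltonian ℂ d}
    (hH : hamNorm (fieldWt h (L : ℝ) d k) ((L : ℝ) ^ k) (L ^ (d * k)) H ≤ 1 / 8)
    {K : Finset (Fin d → ZMod M) → ((Fin d → ZMod M) → ℝ) → ℂ} {C : ℝ} (hC : 0 ≤ C)
    (hK : WeakNormLE (abkmNormParams L N Mord R p r₀ h θbar A (schedDelta δ₀ δ₁ N) 𝒞) k K C)
    (hKfac : Factorises (L ^ k) K) (hK0 : ∀ φ, K ∅ φ = 1) (hKd : ∀ Y, ContDiff ℝ r₀ (K Y))
    (hKloc : ∀ Y, IsPolymer (L ^ k) Y → IsConn Y →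
      IsGaugeLocal ((abkmNormParams L N Mord R p r₀ h θbar A (schedDelta δ₀ δ₁ N) 𝒞).gauge k Y) (K Y)) :
    ContDiff ℝ r₀ (fluct (𝒞 (k + 1)) (polyP2 (L ^ k) H K X)) := by
  set P := abkmNormParams L N Mord R p r₀ h θbar A (schedDelta δ₀ δ₁ N) 𝒞 with hP
  have hL0 : (0 : ℝ) < L := by exact_mod_cast hLodd.pos
  have hk1 : k + 1 ≤ N + 1 := by omega
  have hP2 := tayNormLE_polyP2_abkm hd hLodd hM hkN hp hMord hB hδ₀ hδ₁ hh hh0 hA hX hH hC hK hKfac hK0 hKd hKloc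
  have hb0 : (0 : ℝ) ≤ ∑ Y ∈ polys (L ^ k) X, (∏ _B ∈ blocks (L ^ k) (X \ Y),
      8 * Real.exp (1 / 4) * hamNorm (fieldWt h (L : ℝ) d k) ((L : ℝ) ^ k) (L ^ (d * k)) H) *
      ∏ Z ∈ components Y, C * P.aFactor k Z := by
    have hnn : 0 ≤ hamNorm (fieldWt h (L : ℝ) d k) ((L : ℝ) ^ k) (L ^ (d * k)) H :=
      hamNorm_nonneg (fieldWt_pos hh hL0 d k).le (by positivity) _ H
    exact sum_nonneg fun Y _ => mul_nonneg (prod_nonneg fun _ _ => by positivity)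
      (prod_nonneg fun Z _ => mul_nonneg hC (WeakNormLE.aFactor_pos hA k Z).le)
  exact contDiff_fluct_abkm hθbar hlam hB hk1 X (P.gauge k X) hb0 (contDiff_polyP2 _ H hKd X)
    (isGaugeLocal_polyP2_abkm hLodd hM (by omega) hh hp H hKfac hK0 hKloc hX) hP2

/-- **`R_{k+1}P₂(e^{−H},K)(X₂)` is local for `T_k^{X₂*}`** (torus data).
[cite: AdamsBuchholzKoteckyMuller2019, Lemma 6.4 (2) / Lemma 9.4] -/
theorem isGaugeLocal_fluct_polyP2_abkm {L N Mord R p r₀ : ℕ} {θbar h A : ℝ} {δ : ℕ → ℝ}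
    {𝒞 : ℕ → (Fin d → ZMod M) → ℝ} (hLodd : Odd L) (hM : M = L ^ N) {k : ℕ} (hk : k ≤ N)
    (hh : 0 < h) (hp : d / 2 + 1 ≤ p) (H : RelevantHamiltonian ℂ d) (𝒞' : (Fin d → ZMod M) → ℝ)
    {K : Finset (Fin d → ZMod M) → ((Fin d → ZMod M) → ℝ) → ℂ}
    (hKfac : Factorises (L ^ k) K) (hK0 : ∀ φ, K ∅ φ = 1)
    (hKloc : ∀ Y, IsPolymer (L ^ k) Y → IsConn Y →
      IsGaugeLocal ((abkmNormParams L N Mord R p r₀ h θbar A δ 𝒞).gauge k Y) (K Y))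
    {Z : Finset (Fin d → ZMod M)} (hZ : IsPolymer (L ^ k) Z) :
    IsGaugeLocal ((abkmNormParams L N Mord R p r₀ h θbar A δ 𝒞).gauge k Z)
      (fluct 𝒞' (polyP2 (L ^ k) H K Z)) :=
  isGaugeLocal_fluct _ 𝒞' (isGaugeLocal_polyP2_abkm hLodd hM hk hh hp H hKfac hK0 hKloc hZ)

/-- **Lipschitz form: `|R_{k+1}P₂(e^{−H},K)(X₂) − R_{k+1}P₂(e^{−H'},K')(X₂)|_{T_k^{X₂*}, w_{k:k+1}^{X₂}}
≤ b'_{P₂} · A_𝒫^{|X₂|_k}`** with the constant `b'_{P₂}` of `PolymerProductLipschitzABKM.tayNormLE_P2_sub_abkm`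
(`‖H‖_{k,0}, ‖H'‖_{k,0} ≤ 1/16`, `‖K‖, ‖K'‖ ≤ C`, `‖K − K'‖ ≤ C_Δ`): `R_{k+1}` is linear on the integrable
functionals `P₂(·)(X₂)(φ + ·)`, then Lemma 8.4 on arbitrary polymers.
[cite: AdamsBuchholzKoteckyMuller2019, Lemma 9.4 / Lemma 9.7 (R₁ is linear) / Lemma 8.4] -/
theorem tayNormLE_fluct_polyP2_sub_abkm {L N Mord R n p r₀ : ℕ} {θbar lam μ δ₁ δ₀ A𝒫 h A : ℝ}
    {𝒞 : ℕ → (Fin d → ZMod M) → ℝ} (hd : 2 ≤ d) (hLodd : Odd L)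
    (hM : M = L ^ N) {k : ℕ} (hkN : k + 1 ≤ N) (hp : d / 2 + 1 ≤ p) (hMord : d / 2 + 1 ≤ Mord)
    (hθbar : 0 < θbar) (hlam : 0 < lam)
    (hB : AbkmWeightBounds L N Mord R n θbar lam μ δ₁ δ₀ A𝒫 𝒞
      (abkmWeightData L N Mord R θbar (schedDelta δ₀ δ₁ N) 𝒞))
    (hδ₀ : 0 < δ₀) (hδ₁ : 0 < δ₁) (hh : 0 < h) (hh0 : hZeroSq d R δ₀ δ₁ ≤ h ^ 2) (hA : 0 < A)
    {X : Finset (Fin d → ZMod M)} (hX : IsPolymer (L ^ k) X)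
    {H H' : RelevantHamiltonian ℂ d}
    (hH : hamNorm (fieldWt h (L : ℝ) d k) ((L : ℝ) ^ k) (L ^ (d * k)) H ≤ 1 / 16)
    (hH' : hamNorm (fieldWt h (L : ℝ) d k) ((L : ℝ) ^ k) (L ^ (d * k)) H' ≤ 1 / 16)
    {K K' : Finset (Fin d → ZMod M) → ((Fin d → ZMod M) → ℝ) → ℂ} {C CΔ : ℝ} (hC : 0 ≤ C) (hCΔ : 0 ≤ CΔ)
    (hK : WeakNormLE (abkmNormParams L N Mord R p r₀ h θbar A (schedDelta δ₀ δ₁ N) 𝒞) k K C)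
    (hK' : WeakNormLE (abkmNormParams L N Mord R p r₀ h θbar A (schedDelta δ₀ δ₁ N) 𝒞) k K' C)
    (hΔ : WeakNormLE (abkmNormParams L N Mord R p r₀ h θbar A (schedDelta δ₀ δ₁ N) 𝒞) k (K - K') CΔ)
    (hKfac : Factorises (L ^ k) K) (hK0 : ∀ φ, K ∅ φ = 1) (hKd : ∀ Y, ContDiff ℝ r₀ (K Y))
    (hK'fac : Factorises (L ^ k) K') (hK'0 : ∀ φ, K' ∅ φ = 1) (hK'd : ∀ Y, ContDiff ℝ r₀ (K' Y))
    (hKloc : ∀ Y, IsPolymer (L ^ k) Y → IsConn Y →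
      IsGaugeLocal ((abkmNormParams L N Mord R p r₀ h θbar A (schedDelta δ₀ δ₁ N) 𝒞).gauge k Y) (K Y))
    (hK'loc : ∀ Y, IsPolymer (L ^ k) Y → IsConn Y →
      IsGaugeLocal ((abkmNormParams L N Mord R p r₀ h θbar A (schedDelta δ₀ δ₁ N) 𝒞).gauge k Y) (K' Y)) :
    TayNormLE ((abkmNormParams L N Mord R p r₀ h θbar A (schedDelta δ₀ δ₁ N) 𝒞).gauge k X) r₀
      ((abkmWeightData L N Mord R θbar (schedDelta δ₀ δ₁ N) 𝒞).midWeight k X)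
      (fun φ => fluct (𝒞 (k + 1)) (polyP2 (L ^ k) H K X) φ - fluct (𝒞 (k + 1)) (polyP2 (L ^ k) H' K' X) φ)
      ((∑ Y ∈ polys (L ^ k) X,
        (((∏ _B ∈ blocks (L ^ k) (X \ Y),
            (8 * Real.exp (1 / 4) * hamNorm (fieldWt h (L : ℝ) d k) ((L : ℝ) ^ k) (L ^ (d * k)) H' +
              16 * Real.exp (3 / 8) * hamNorm (fieldWt h (L : ℝ) d k) ((L : ℝ) ^ k) (L ^ (d * k)) (H - H'))) -
          ∏ _B ∈ blocks (L ^ k) (X \ Y),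
            8 * Real.exp (1 / 4) * hamNorm (fieldWt h (L : ℝ) d k) ((L : ℝ) ^ k) (L ^ (d * k)) H') *
          ∏ Z ∈ components Y, C * (abkmNormParams L N Mord R p r₀ h θbar A (schedDelta δ₀ δ₁ N) 𝒞).aFactor k Z +
        (∏ _B ∈ blocks (L ^ k) (X \ Y),
            8 * Real.exp (1 / 4) * hamNorm (fieldWt h (L : ℝ) d k) ((L : ℝ) ^ k) (L ^ (d * k)) H') *
          ((∏ Z ∈ components Y,
              (C * (abkmNormParams L N Mord R p r₀ h θbar A (schedDelta δ₀ δ₁ N) 𝒞).aFactor k Z +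
                CΔ * (abkmNormParams L N Mord R p r₀ h θbar A (schedDelta δ₀ δ₁ N) 𝒞).aFactor k Z)) -
            ∏ Z ∈ components Y, C * (abkmNormParams L N Mord R p r₀ h θbar A (schedDelta δ₀ δ₁ N) 𝒞).aFactor k Z))) *
        A𝒫 ^ numBlocks (L ^ k) X) := by
  set P := abkmNormParams L N Mord R p r₀ h θbar A (schedDelta δ₀ δ₁ N) 𝒞 with hP
  set W := abkmWeightData L N Mord R θbar (schedDelta δ₀ δ₁ N) 𝒞 with hW
  have hL0 : (0 : ℝ) < L := by exact_mod_cast hLodd.pos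
  have hk1 : k + 1 ≤ N + 1 := by omega
  have hH8 : hamNorm (fieldWt h (L : ℝ) d k) ((L : ℝ) ^ k) (L ^ (d * k)) H ≤ 1 / 8 := by linarith
  have hH8' : hamNorm (fieldWt h (L : ℝ) d k) ((L : ℝ) ^ k) (L ^ (d * k)) H' ≤ 1 / 8 := by linarith
  have hnn : ∀ H₀ : RelevantHamiltonian ℂ d,
      0 ≤ hamNorm (fieldWt h (L : ℝ) d k) ((L : ℝ) ^ k) (L ^ (d * k)) H₀ := fun H₀ =>
    hamNorm_nonneg (fieldWt_pos hh hL0 d k).le (by positivity) _ H₀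
  -- the difference of the two `P₂`'s and its bound
  have hdiff := tayNormLE_P2_sub_abkm hd hLodd hM hkN hp hMord hB hδ₀ hδ₁ hh hh0 hA hX hH hH' hC hCΔ hK hK' hΔ
    hKfac hK0 hKd hK'fac hK'0 hK'd hKloc hK'loc
  have hfun : (fun φ => ∑ Y ∈ polys (L ^ k) X, bprod (L ^ k) (fun B => expNegH H B φ - 1) (X \ Y) * K Y φ -
        ∑ Y ∈ polys (L ^ k) X, bprod (L ^ k) (fun B => expNegH H' B φ - 1) (X \ Y) * K' Y φ) =
      fun φ => polyP2 (L ^ k) H K X φ - polyP2 (L ^ k) H' K' X φ := by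
    funext φ; rfl
  rw [hfun] at hdiff
  -- nonnegativity of the Lipschitz constant
  have haF : ∀ Z, 0 ≤ P.aFactor k Z := fun Z => (WeakNormLE.aFactor_pos hA k Z).le
  have hρ0 : (0 : ℝ) ≤ ∑ Y ∈ polys (L ^ k) X,
      (((∏ _B ∈ blocks (L ^ k) (X \ Y),
          (8 * Real.exp (1 / 4) * hamNorm (fieldWt h (L : ℝ) d k) ((L : ℝ) ^ k) (L ^ (d * k)) H' +
            16 * Real.exp (3 / 8) * hamNorm (fieldWt h (L : ℝ) d k) ((L : ℝ) ^ k) (L ^ (d * k)) (H - H'))) -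
        ∏ _B ∈ blocks (L ^ k) (X \ Y),
          8 * Real.exp (1 / 4) * hamNorm (fieldWt h (L : ℝ) d k) ((L : ℝ) ^ k) (L ^ (d * k)) H') *
        ∏ Z ∈ components Y, C * P.aFactor k Z +
      (∏ _B ∈ blocks (L ^ k) (X \ Y),
          8 * Real.exp (1 / 4) * hamNorm (fieldWt h (L : ℝ) d k) ((L : ℝ) ^ k) (L ^ (d * k)) H') *
        ((∏ Z ∈ components Y, (C * P.aFactor k Z + CΔ * P.aFactor k Z)) -
          ∏ Z ∈ components Y, C * P.aFactor k Z)) := by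
    have h1 := hnn H'; have h2 := hnn (H - H')
    refine sum_nonneg fun Y _ => add_nonneg (mul_nonneg ?_ ?_) (mul_nonneg ?_ ?_)
    · exact sub_nonneg.2 (prod_le_prod (fun _ _ => by positivity) fun _ _ => by
        have : (0 : ℝ) ≤ 16 * Real.exp (3 / 8) *
          hamNorm (fieldWt h (L : ℝ) d k) ((L : ℝ) ^ k) (L ^ (d * k)) (H - H') := by positivity
        linarith)
    · exact prod_nonneg fun Z _ => mul_nonneg hC (haF Z)
    · exact prod_nonneg fun _ _ => by positivity
    · exact sub_nonneg.2 (prod_le_prod (fun Z _ => mul_nonneg hC (haF Z)) fun Z _ =>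
        le_add_of_nonneg_right (mul_nonneg hCΔ (haF Z)))
  -- smoothness and locality of both `P₂`'s
  have hcd := contDiff_polyP2 (L ^ k) H hKd X
  have hcd' := contDiff_polyP2 (L ^ k) H' hK'd X
  have hloc := isGaugeLocal_polyP2_abkm (Mord := Mord) (R := R) (r₀ := r₀) (θbar := θbar) (A := A)
    (δ := schedDelta δ₀ δ₁ N) (𝒞 := 𝒞) hLodd hM (by omega : k ≤ N) hh hp H hKfac hK0 hKloc hX
  have hloc' := isGaugeLocal_polyP2_abkm (Mord := Mord) (R := R) (r₀ := r₀) (θbar := θbar) (A := A)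
    (δ := schedDelta δ₀ δ₁ N) (𝒞 := 𝒞) hLodd hM (by omega : k ≤ N) hh hp H' hK'fac hK'0 hK'loc hX
  have hlocΔ : IsGaugeLocal (P.gauge k X) (fun φ => polyP2 (L ^ k) H K X φ - polyP2 (L ^ k) H' K' X φ) :=
    fun φ ψ e => by
      show polyP2 (L ^ k) H K X φ - polyP2 (L ^ k) H' K' X φ = polyP2 (L ^ k) H K X ψ - polyP2 (L ^ k) H' K' X ψ
      rw [hloc φ ψ e, hloc' φ ψ e]
  -- `R` of the difference
  have hR := tayNormLE_fluct_abkm hθbar hlam hB hk1 hX (P.gauge k X) hρ0 (hcd.sub hcd') hlocΔ hdiff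
  -- linearity of `R` on the two integrable functionals
  have hdom := weightSectionDominated_abkm hθbar hlam hB hk1 X (P.gauge k X)
  have hP2 := tayNormLE_polyP2_abkm hd hLodd hM hkN hp hMord hB hδ₀ hδ₁ hh hh0 hA hX hH8 hC hK hKfac hK0 hKd hKloc
  have hP2' := tayNormLE_polyP2_abkm hd hLodd hM hkN hp hMord hB hδ₀ hδ₁ hh hh0 hA hX hH8' hC hK' hK'fac hK'0
    hK'd hK'loc
  have hb0 : ∀ H₀ : RelevantHamiltonian ℂ d, (0 : ℝ) ≤ ∑ Y ∈ polys (L ^ k) X, (∏ _B ∈ blocks (L ^ k) (X \ Y),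
      8 * Real.exp (1 / 4) * hamNorm (fieldWt h (L : ℝ) d k) ((L : ℝ) ^ k) (L ^ (d * k)) H₀) *
      ∏ Z ∈ components Y, C * P.aFactor k Z := fun H₀ => by
    have := hnn H₀
    exact sum_nonneg fun Y _ => mul_nonneg (prod_nonneg fun _ _ => by positivity)
      (prod_nonneg fun Z _ => mul_nonneg hC (haF Z))
  have hint : ∀ φ, Integrable (fun ξ => polyP2 (L ^ k) H K X (φ + ξ)) (stepMeasure (𝒞 (k + 1))) :=
    fun φ => integrable_comp_add_of_tayNormLE hP2 (hb0 H) hcd hloc hdom φ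
  have hint' : ∀ φ, Integrable (fun ξ => polyP2 (L ^ k) H' K' X (φ + ξ)) (stepMeasure (𝒞 (k + 1))) :=
    fun φ => integrable_comp_add_of_tayNormLE hP2' (hb0 H') hcd' hloc' hdom φ
  have heq : fluct (𝒞 (k + 1)) (fun φ => polyP2 (L ^ k) H K X φ - polyP2 (L ^ k) H' K' X φ) =
      fun φ => fluct (𝒞 (k + 1)) (polyP2 (L ^ k) H K X) φ - fluct (𝒞 (k + 1)) (polyP2 (L ^ k) H' K' X) φ := by
    funext φ
    unfold fluct
    exact integral_sub (hint φ) (hint' φ)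
  rw [heq] at hR
  exact hR

end Literature.MathematicalPhysics.StatisticalMechanics.GradientRG

end
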